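import Summits.QuantumAdvantage.QuantumAdvantage.Theorems.WbwObfuscatedGluedTreesKowFPExtension

/-!
# Stub `stub_fpEnumeration` — the class `FP` is enumerated by one sequence of total string functions
# (crux `WbwObfuscatedGluedTrees`, stmt-QuantumAdvantage-2340; line `knowledge-of-walk-split`, stage 4, lead c3)

Registered stub of the stage-4 skeleton (target `…Generator.Residual.ResidualAudit`): there is a sequence
`seq : ℕ → (List Bool → List Bool)` with `F ∈ Set.range seq` for every `F ∈ FP` (equality of FUNCTIONS).
Proof: every `F ∈ FP` is (as a total function, by `funext`) an extension brick
`FPExtension.extFn (ClockedUS.ecode M) ((ClockedUA.pM M).comp p)` of its own machine `M` clocked by its own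
polynomial `p` (`ClockedUS.sim`), and the index type `List Bool × Polynomial ℕ` of the bricks is countable
(`Polynomial ℕ ↪ (ℕ →₀ ℕ) ↪ Finset (ℕ × ℕ)` by `toFinsupp`, `AddMonoidAlgebra.coeff`, `Finsupp.graph`).
Generic complexity plumbing; no crux content.
-/

set_option linter.dupNamespace false

noncomputable section

namespace Summit.QuantumAdvantage.QuantumAdvantage.Theorems.WbwObfuscatedGluedTrees.KnowledgeOfWalk.Residual

open Literature.Computability.Cryptography Literature.Computability.Complexity
open _root_.Computability Polynomial

/-- Every `F ∈ FP` IS an extension brick: `extFn (ecode M) (p_M ∘ p) = F` for a machine `M` computing `F`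
in time `p` (the brick agrees with `F` on every string since the encoders are `id`).
[cite: AroraBarakCC2009, Thm. 1.9 and §1.4.1] -/
theorem exists_extFn_eq_of_mem_FP {F : List Bool → List Bool} (hF : F ∈ FP) :
    ∃ (e : List Bool) (Q : Polynomial ℕ), FPExtension.extFn e Q = F := by
  have hF' : PolyTimeComputable id id F := hF
  obtain ⟨p, M, hM⟩ := hF'
  refine ⟨ClockedUS.ecode M, (ClockedUA.pM M).comp p, funext fun x => ?_⟩
  apply FPExtension.extFn_apply_of_run
  rw [Polynomial.eval_comp]
  exact ClockedUS.sim M (hM x)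

/-- **Stub `stub_fpEnumeration`**: one sequence of total string functions hits every member of `FP`
exactly (as a function).  Enumerate the countable index type `List Bool × Polynomial ℕ` of the extension
bricks `extFn e Q` (`Polynomial ℕ ↪ (ℕ →₀ ℕ) ↪ Finset (ℕ × ℕ)` is countable, cf.
`Literature.Computability.QuantumComplexity.countable_polynomial_nat`) and use `exists_extFn_eq_of_mem_FP`.
[folklore] -/
theorem stub_fpEnumeration :
    ∃ seq : ℕ → (List Bool → List Bool), ∀ F : List Bool → List Bool, F ∈ FP → ∃ i, seq i = F := by
  have : Countable (Polynomial ℕ) :=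
    have : Countable (ℕ →₀ ℕ) := (Finsupp.graph_injective ℕ ℕ).countable
    (AddMonoidAlgebra.coeff_injective.comp Polynomial.toFinsupp_injective).countable
  obtain ⟨g, hg⟩ := exists_surjective_nat (List Bool × Polynomial ℕ)
  refine ⟨fun i => FPExtension.extFn (g i).1 (g i).2, fun F hF => ?_⟩
  obtain ⟨e, Q, heQ⟩ := exists_extFn_eq_of_mem_FP hF
  obtain ⟨i, hi⟩ := hg (e, Q)
  refine ⟨i, ?_⟩
  show FPExtension.extFn (g i).1 (g i).2 = F
  rw [hi]
  exact heQ

end Summit.QuantumAdvantage.QuantumAdvantage.Theorems.WbwObfuscatedGluedTrees.KnowledgeOfWalk.Residual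

end
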